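import Mathlib
import HarnessLib

/-!
# HodgeLocusCensusGorensteinCore — kernel-checked core of the ALL-DEGREE FERMAT-PAIRS record (cell pub-hlocus, LEAD gen 29; FORTIETH ADDENDUM)
HONEST FRAMING: certified instances and evidence bearing on the general Hodge conjecture; no claim.

Structural helper of the Hodge-locus census; nothing here is used by, or claims anything about, `Summit.HodgeConjecture`.
Record: `data/ivhs/census/og81/FERMAT-PAIRS-ALL-DEGREES-g29.md` (THEOREM 1: the first-order keys of every pair of standard
planes at the Fermat point of any degree `d ≥ 3`).  What is kernel-checked here, over an arbitrary field / commutative ring: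

* `alive_iff_mem_sup` — the PENCIL CRITERION of the proof of THEOREM 1 (iv), step (2): for linear maps `A B : V → W`,
  `μ ≠ 0` and a common image vector `A f = B g`, the vector `A f` is hit by some `r ∈ ker (A + μ B)` with `A r = A f`
  iff `μ f + g ∈ ker A + ker B`.  In the census dictionary `A, B` are the multiplications by the two plane classes on a
  graded piece of the Jacobian ring, `ker (A + μ B)` modulo `ker A ∩ ker B` is the first-order excess space, and the
  criterion turns the excess into the kernel of a pencil of maps `J → R/(ker A + ker B)`.
* `edgeClass_mul_linear`, `edgeClass_mul_linear_eq_zero` — the EDGE LEMMA (L1) as a ring identity: with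
  `u_c(x, y) = Σ_{j=0}^{n} c^{j+1} x^{n-j} y^j` (`n = d - 2`), `u_c(x,y) · (x - c y) = c x^{n+1} - c^{n+2} y^{n+1}`, hence `= 0`
  in any ring where `x^{d-1} = y^{d-1} = 0` — for EVERY scalar `c`, which is why an inconsistent common edge still has both
  classes killed by both linear forms.
* `fourCycle_special_value` — the arithmetic of the CONSISTENT 4-CYCLE at its bottom degree (proof of (iv), step (4)):
  with holonomy `ε₁ η₁ ε₂ η₂ = 1` and `ε₂^d = -1`, the ratio `-κ g₀(p) / f₀(p)` with `κ = (η₁ η₂)^{d-1}`,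
  `f₀(p) = (d-1) η₁ ε₂ ε₁^{-(d-2)}`, `g₀(p) = (d-1) ε₁ η₁` equals `+1`; stated multiplied out (the common factor `d - 1` dropped).
* `special_value_sign` — the assembly of the factor states (step (5)): `-( (1)^{n₂} · (-1)^b ) = (-1)^{b+1}`.
* `transversality_arith`, `c_eq_cN` — the identity behind THEOREM 1 (ii) at `t = d`:
  `(m+1)(2k-m-1) + 2k(k-1-m) = 2k² - (m+1)²`, so `2(C(k-1+d,d) - k²) - (C(m+d,d) - (m+1)²) = c_N(k,m,d)`.
* `rankAlpha_table_d` — the printed ranks `h_k(d) = C(k-1+d, d) - k²` for the (d, k) of the record's engines and kit plan.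
-/

namespace Summit.HodgeConjecture.HodgeConjecture.HodgeLocus.Census.GorensteinCore

section Pencil

variable {K : Type*} [Field K] {V W : Type*} [AddCommGroup V] [Module K V] [AddCommGroup W] [Module K W]

/-- PENCIL CRITERION.  For `μ ≠ 0` and `A f = B g`:
`(∃ r, A r = A f ∧ (A + μ • B) r = 0) ↔ μ • f + g ∈ ker A ⊔ ker B`. -/
theorem alive_iff_mem_sup (A B : V →ₗ[K] W) (μ : K) (hμ : μ ≠ 0) (f g : V) (hfg : A f = B g) :
    (∃ r : V, A r = A f ∧ (A + μ • B) r = 0) ↔ μ • f + g ∈ LinearMap.ker A ⊔ LinearMap.ker B := by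
  constructor
  · rintro ⟨r, hAr, hr⟩
    have hr' : A r + μ • B r = 0 := by
      simpa only [LinearMap.add_apply, LinearMap.smul_apply] using hr
    rw [Submodule.mem_sup]
    refine ⟨μ • (f - r), ?_, μ • r + g, ?_, ?_⟩
    · rw [LinearMap.mem_ker, LinearMap.map_smul, LinearMap.map_sub, hAr, sub_self, smul_zero]
    · rw [LinearMap.mem_ker, LinearMap.map_add, LinearMap.map_smul, ← hfg, ← hAr]
      rw [add_comm] at hr'
      simpa using hr'
    · rw [smul_sub]; abel
  · intro h
    rw [Submodule.mem_sup] at h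
    obtain ⟨a, ha, b, hb, hab⟩ := h
    rw [LinearMap.mem_ker] at ha hb
    refine ⟨f - μ⁻¹ • a, ?_, ?_⟩
    · rw [LinearMap.map_sub, LinearMap.map_smul, ha, smul_zero, sub_zero]
    · have hμr : μ • (f - μ⁻¹ • a) = b - g := by
        rw [smul_sub, smul_smul, mul_inv_cancel₀ hμ, one_smul, sub_eq_sub_iff_add_eq_add, add_comm b a]
        exact hab.symm
      have hB : B (μ • (f - μ⁻¹ • a)) = -B g := by rw [hμr, map_sub, hb, zero_sub]
      have hA : A (f - μ⁻¹ • a) = A f := by rw [map_sub, map_smul, ha, smul_zero, sub_zero]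
      rw [LinearMap.add_apply, LinearMap.smul_apply, ← LinearMap.map_smul, hB, hA, hfg, add_neg_cancel]

end Pencil

section Edge

variable {S : Type*} [CommRing S]

/-- EDGE LEMMA (L1) as a ring identity: `(Σ_{j ≤ n} c^{j+1} x^{n-j} y^j) · (x - c y) = c x^{n+1} - c^{n+2} y^{n+1}`. -/
theorem edgeClass_mul_linear (x y c : S) (n : ℕ) :
    (∑ j ∈ Finset.range (n + 1), c ^ (j + 1) * x ^ (n - j) * y ^ j) * (x - c * y) =
      c * x ^ (n + 1) - c ^ (n + 2) * y ^ (n + 1) := by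
  have hsum : (∑ j ∈ Finset.range (n + 1), c ^ (j + 1) * x ^ (n - j) * y ^ j) =
      c * ∑ i ∈ Finset.range (n + 1), (c * y) ^ i * x ^ (n + 1 - 1 - i) := by
    rw [Finset.mul_sum]
    refine Finset.sum_congr rfl fun i hi => ?_
    rw [Nat.add_sub_cancel, mul_pow]; ring
  rw [hsum, mul_assoc, show (x - c * y) = -((c * y) - x) by ring, mul_neg, geom_sum₂_mul]
  ring

/-- In a ring where `x^{n+1} = y^{n+1} = 0` (the one-edge Jacobian ring, `n = d - 2`) the edge class is killed by
`x - c y` for EVERY scalar `c`. -/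
theorem edgeClass_mul_linear_eq_zero (x y c : S) (n : ℕ) (hx : x ^ (n + 1) = 0) (hy : y ^ (n + 1) = 0) :
    (∑ j ∈ Finset.range (n + 1), c ^ (j + 1) * x ^ (n - j) * y ^ j) * (x - c * y) = 0 := by
  rw [edgeClass_mul_linear, hx, hy, mul_zero, mul_zero, sub_zero]

end Edge

section FourCycle

variable {K : Type*} [Field K]

/-- CONSISTENT 4-CYCLE, bottom degree: with holonomy `ε₁ η₁ ε₂ η₂ = 1` and `ε₂^{n+2} = -1` (`n = d - 2`),
`-(η₁ η₂)^{n+1} · (ε₁ η₁) = η₁ ε₂ (ε₁⁻¹)^n`, i.e. `λ_Z = -κ g₀(p)/f₀(p) = +1`. -/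
theorem fourCycle_special_value (n : ℕ) (ε₁ η₁ ε₂ η₂ : K) (hε₁ : ε₁ ≠ 0) (hε₂ : ε₂ ≠ 0)
    (hhol : ε₁ * η₁ * ε₂ * η₂ = 1) (hε₂d : ε₂ ^ (n + 2) = -1) :
    -(η₁ * η₂) ^ (n + 1) * (ε₁ * η₁) = η₁ * ε₂ * (ε₁⁻¹) ^ n := by
  have hη : η₁ * η₂ = (ε₁ * ε₂)⁻¹ := by
    have hne : ε₁ * ε₂ ≠ 0 := mul_ne_zero hε₁ hε₂
    field_simp
    linear_combination hhol
  rw [hη, inv_pow, inv_pow]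
  have hne' : (ε₁ * ε₂) ^ (n + 1) ≠ 0 := pow_ne_zero _ (mul_ne_zero hε₁ hε₂)
  have hne'' : ε₁ ^ n ≠ 0 := pow_ne_zero _ hε₁
  field_simp
  have h2 : ε₂ ^ (n + 2) = ε₂ ^ (n + 1) * ε₂ := pow_succ ε₂ (n + 1)
  rw [h2] at hε₂d
  linear_combination (-(η₁ * ε₁ ^ (n + 1))) * hε₂d

/-- The special value `λ_Z = +1` in ratio form. -/
theorem fourCycle_special_value_div (n : ℕ) (ε₁ η₁ ε₂ η₂ : K) (hε₁ : ε₁ ≠ 0) (hη₁ : η₁ ≠ 0) (hε₂ : ε₂ ≠ 0)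
    (hhol : ε₁ * η₁ * ε₂ * η₂ = 1) (hε₂d : ε₂ ^ (n + 2) = -1) :
    -(η₁ * η₂) ^ (n + 1) * (ε₁ * η₁) / (η₁ * ε₂ * (ε₁⁻¹) ^ n) = 1 := by
  rw [fourCycle_special_value n ε₁ η₁ ε₂ η₂ hε₁ hε₂ hhol hε₂d]
  have : η₁ * ε₂ * (ε₁⁻¹) ^ n ≠ 0 := mul_ne_zero (mul_ne_zero hη₁ hε₂) (pow_ne_zero _ (inv_ne_zero hε₁))
  exact div_self this

/-- ASSEMBLY OF THE FACTOR STATES: `n₂` consistent 2-cycles (`λ_Z = -1`) and `b` consistent 4-cycles at the bottom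
(`λ_Z = +1`) give the special value `-∏(-λ_Z) = -(1^{n₂} (-1)^b) = (-1)^{b+1}`. -/
theorem special_value_sign (b n₂ : ℕ) : -((-(-1 : ℤ)) ^ n₂ * (-(1 : ℤ)) ^ b) = (-1) ^ (b + 1) := by
  rw [neg_neg, one_pow, one_mul, pow_succ]; ring

end FourCycle

section Transversality

/-- `(m+1)(2k-m-1) + 2k(k-1-m) = 2k² - (m+1)²` (dimension of the pairs of `(k-1)`-planes meeting in a `P^m`, rewritten). -/
theorem transversality_arith (k m : ℤ) : (m + 1) * (2 * k - m - 1) + 2 * k * (k - 1 - m) = 2 * k ^ 2 - (m + 1) ^ 2 := by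
  ring

/-- THEOREM 1 (ii) at `t = d`: `c_d = 2 h_k(d) - h_{m+1}(d)` with `h_n(d) = C(n-1+d, d) - n²` equals the pair-locus
codimension `c_N(k, m, d) = 2 C(k-1+d, d) - C(m+d, d) - [(m+1)(2k-m-1) + 2k(k-1-m)]`, for every type. -/
theorem c_eq_cN (d k m : ℕ) :
    2 * (((k - 1 + d).choose d : ℤ) - (k : ℤ) ^ 2) - (((m + d).choose d : ℤ) - ((m : ℤ) + 1) ^ 2) =
      2 * ((k - 1 + d).choose d : ℤ) - ((m + d).choose d : ℤ) -
        (((m : ℤ) + 1) * (2 * k - m - 1) + 2 * k * ((k : ℤ) - 1 - m)) := by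
  ring

/-- UNIFORM THRESHOLD window count: `d - c′(d-2) < 0 ↔ d < c′ (d - 2)` is `threshold_iff` of QuarticCore; here the
complementary fact used in COROLLARY 2: for `d ≥ 5` and `c′ ≥ 2` the window is empty. -/
theorem threshold_d_ge_five (d c : ℕ) (hd : 5 ≤ d) (hc : 2 ≤ c) : d < c * (d - 2) := by
  have h1 : 2 * (d - 2) ≤ c * (d - 2) := Nat.mul_le_mul_right _ hc
  omega

/-- The printed ranks `rank α_d = h_k(d) = C(k-1+d, d) - k²` for the engines' and the kit plan's `(d, k)`:
`d = 5: k = 3, 4, 5 ↦ 12, 40, 101`; `d = 6: k = 3, 4 ↦ 19, 68`; `d = 7: k = 3, 4 ↦ 27, 104`; `d = 8, 9, 10, k = 3 ↦ 36, 46, 57`;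
and `d = 4, k = 7 ↦ 161`, `d = 3, k = 10 ↦ 120` (`= C(10,3)`). -/
theorem rankAlpha_table_d :
    Nat.choose 7 5 - 3 ^ 2 = 12 ∧ Nat.choose 8 5 - 4 ^ 2 = 40 ∧ Nat.choose 9 5 - 5 ^ 2 = 101 ∧
    Nat.choose 8 6 - 3 ^ 2 = 19 ∧ Nat.choose 9 6 - 4 ^ 2 = 68 ∧
    Nat.choose 9 7 - 3 ^ 2 = 27 ∧ Nat.choose 10 7 - 4 ^ 2 = 104 ∧
    Nat.choose 10 8 - 3 ^ 2 = 36 ∧ Nat.choose 11 9 - 3 ^ 2 = 46 ∧ Nat.choose 12 10 - 3 ^ 2 = 57 ∧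
    Nat.choose 10 4 - 7 ^ 2 = 161 ∧ Nat.choose 12 3 - 10 ^ 2 = 120 := by
  decide

end Transversality

end Summit.HodgeConjecture.HodgeConjecture.HodgeLocus.Census.GorensteinCore
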